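import Literature.AlgebraicGeometry.Resolution.MarkedIdeals
import HarnessLib

/-!
# [OURS · L1 W4.6 rung (ii)] `CampaignW46.SNCAt L y` — simple normal crossings of a boundary list AT ONE POINT (statement-only typing +
# the unfolding lemma; res-D-pv-049 AS res-L1-s46-pv-11's SPLIT-OFFER 2026-08-27T05:57:54Z (T), custody res-plan-2 05:58:37Z)

Everything here is OURS. The tree's `Literature.AlgebraicGeometry.Resolution.HasSNCWith E C` [BierstoneGrigorievMilmanWlodarczyk2011, Def.
3.1.1 / 3.1.3 (2)] is a `∀ x` of a pointwise condition; `HasSNC E := HasSNCWith E ⊤`, whose centre clause `x ∈ (⊤).support → …` is vacuous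
(`Scheme.IdealSheafData.support_top : support ⊤ = ⊥`). The rung-(ii-2) bricks of the d = 2 proof (pv-11's B11a TRANSPORT along an open
immersion, B11b FINITENESS of the non-snc locus on a surface, B7 `orderReducible_of_hasSNC_nhds` p501980) need the condition AT A POINT as a
named predicate: `SNCAt L y` := the pointwise body of `HasSNCWith L ⊤` at `y` WITHOUT the vacuous centre clause, and
`hasSNC_iff_forall_sncAt : HasSNC L ↔ ∀ y, SNCAt L y` (unfolding + `support_top`). Nothing here is a statement of Hironaka's manuscript; no
typed candidate; the BGMW definition enters only by unfolding. Typed by res-L1-type-o1 (OURS typer o1, gen 6, 2026-08-27). Host: MarkedTransfer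
`HypersurfaceOrderReductionDimLeThree` (stmt-ResolutionOfSingularities-16156), `--supports … --as helper`. ROUTE-INDEPENDENT (imports
`Resolution/MarkedIdeals` only). VACUITY: a pointwise slice of an existing definition — exactly as contentful as `HasSNC` (regular stalk + a
regular system of parameters adapted to the divisors of `L` through `y`); satisfiable (empty `L` at a regular point) and refutable (two divisors
with the same stalk ideal through `y`). AI-WRITTEN; NO expert review; AI review is weaker than expert review.
-/

noncomputable section

set_option linter.dupNamespace false -- mandated namespace of this single-conjunct summit

open CategoryTheory AlgebraicGeometry TopologicalSpace IsLocalRing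

namespace Summit.ResolutionOfSingularities.ResolutionOfSingularities.Theorems

namespace CampaignW46

open Literature.AlgebraicGeometry.Resolution
open Scheme.IdealSheafData

universe u

variable {X : Scheme.{u}}

/-- [OURS · L1 W4.6 rung (ii)] replaces the role of «the boundary `E` has simple normal crossings» (BGMW Def. 3.1.1, tree `HasSNC`) READ AT
ONE POINT `y` (res-D-pv-049 AS res-L1-s46-pv-11's SPLIT-OFFER (T), verbatim): the local ring `𝒪_{X,y}` is regular and admits a regular system
of parameters `u_1, …, u_d` (`d` = embedding dimension) such that each divisor of `L` through `y` has stalk ideal `(u_i)` for some `i`, distinct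
divisors getting distinct parameters. `HasSNC L ↔ ∀ y, SNCAt L y` (`hasSNC_iff_forall_sncAt`). NOT a statement of the manuscript.
[cite: BierstoneGrigorievMilmanWlodarczyk2011, Def. 3.1.1] -/
def SNCAt (L : List X.IdealSheafData) (y : X) : Prop :=
  IsRegularLocalRing (X.presheaf.stalk y) ∧
    ∃ u : Fin (maximalIdeal (X.presheaf.stalk y)).spanFinrank → X.presheaf.stalk y,
      Ideal.span (Set.range u) = maximalIdeal (X.presheaf.stalk y) ∧
      ∃ ι : {D // D ∈ L ∧ y ∈ D.support} → Fin (maximalIdeal (X.presheaf.stalk y)).spanFinrank,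
        Function.Injective ι ∧ ∀ D, stalkIdeal D.1 y = Ideal.span {u (ι D)}

/-- Pure logic + `support_top`: **`HasSNC L` is `SNCAt L` at every point** (the centre clause of `HasSNCWith L ⊤` is vacuous because
`(⊤ : X.IdealSheafData).support = ⊥`). [folklore] -/
theorem hasSNC_iff_forall_sncAt (L : List X.IdealSheafData) : HasSNC L ↔ ∀ y, SNCAt L y := by
  refine forall_congr' fun y => and_congr Iff.rfl ⟨?_, ?_⟩
  · rintro ⟨u, hu, hι, -⟩
    exact ⟨u, hu, hι⟩
  · rintro ⟨u, hu, hι⟩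
    refine ⟨u, hu, hι, fun hy => ?_⟩
    rw [Scheme.IdealSheafData.support_top] at hy
    exact absurd (show y ∈ ((⊥ : Closeds X) : Set X) from hy) (by simp [TopologicalSpace.Closeds.coe_bot])

/-- Pure logic: `HasSNC L` gives `SNCAt L y` at each point. [folklore] -/
theorem HasSNC.sncAt {L : List X.IdealSheafData} (h : HasSNC L) (y : X) : SNCAt L y :=
  (hasSNC_iff_forall_sncAt L).mp h y

/-- Pure logic: the pointwise condition everywhere gives `HasSNC`. [folklore] -/
theorem hasSNC_of_forall_sncAt {L : List X.IdealSheafData} (h : ∀ y, SNCAt L y) : HasSNC L :=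
  (hasSNC_iff_forall_sncAt L).mpr h

/-- The regular-stalk half of `SNCAt`. [folklore] -/
theorem SNCAt.isRegularLocalRing {L : List X.IdealSheafData} {y : X} (h : SNCAt L y) :
    IsRegularLocalRing (X.presheaf.stalk y) :=
  h.1

end CampaignW46

end Summit.ResolutionOfSingularities.ResolutionOfSingularities.Theorems

end
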